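import Summits.ValiantsHypothesis.ValiantsHypothesis.Theorems.BarrierLeverChowBenchmarkPairsPeelVandermonde
import Mathlib.Algebra.MvPolynomial.Funext

/-!
# Route BarrierLever — item 22038 `ChowBenchmarkPairs`, line `moore-peel`: SYMBOLIC ITERATION of the peeling lemma —
# every rigidly peelable column family is a GTN instance (a theorem on the typed node `ChowBenchmarkGTN.Stmt.gtn`)

Helper file (`--supports stmt-ValiantsHypothesis-22038`; cell valiant-natproofs, rung V4, 𝒟-side benchmark of record;
seat val-np-p4 gen 21).  Closes NO item.

CONJECTURE GTN (`…ChowBenchmarkPairsGTN.lean`): for every column family through `∅` some table makes the segment-moment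
matrix (rows = all subsets of size `≤ 2` of the points) nonsingular.  THIS FILE proves it for the infinite family of
RIGIDLY PEELABLE column families — those built from the empty family by repeatedly choosing a set `A` contained in no
column so far and adjoining `n+1` new distinct columns containing `A`, one of them `A` itself (`Peelable`):

* `det_genTable_ne_zero` — for a peelable family the determinant of the GENERIC table (`genTable n a c = X_{(a,c)}` in
  `MvPolynomial (Fin n × κ) ℂ`) is a nonzero polynomial.  Induction: the old matrix stays nonsingular under the
  injective `rename` (old points ↦ `Fin.castSucc`); the block `zEntry` of top coefficients is nonzero because its
  evaluation at «new point ↦ 0, old points ↦ the 0/1 indicators of `U j ∖ A`» is `|A|!`·(the Vandermonde block at the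
  indicator table), nonzero by `det_vand_indTable_ne_zero` (`…PeelVandermonde.lean`); the peeling lemma with a generic
  new point (`det_symbMatrixQ_ne_zero`, `…PeelGeneric.lean`) then says the symbolic determinant is nonzero in `R[X]`, and
  the algebra map `X_{(last,c)} ↦ X_{(last,c)} + x·[c ∈ A]` (`MvPolynomial.aeval`) carries the generic determinant of
  `n+1` points onto it (`det_finTable`: re-indexing `Fin (n+1) ≃ Option (Fin n)`, `Row (n+1) ≃ Row n ⊕ Option (Fin n)`
  via `rowEquiv`, built from `rowSet_injective` / `exists_rowSet_eq`).
* `exists_table_of_peelable` — hence some complex table is nonsingular (`MvPolynomial.funext`);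
  `exists_table_of_peelable_enum` — the same in the frame of the node (rows enumerated by `u : Fin r → Finset (Fin h)`,
  entry = the node's `Σ_{g : T → S} …` verbatim).
* tools: `segE_comp_equiv` (relabelling the points), `segE_empty`, `map_starZ` / `map_zEntry`, `zEntry_zero_eq_vand`.

REACH.  The benchmark window `W_h` (first `r_h` binary codes) is rigidly peelable for `h ∈ {1,2,3,4,8}` and for no other
`h ≤ 14` (seat census; memo HOME/val-np-p4/g21/MEMO-gtn-peeling-tropical-valnp4-g21.md §0.4), so this is a theorem about
the conjecture GTN, not a route to `stub_segmentMeanValue`; instantiating `Peelable` at `W_4`, `W_8` (explicit `A`'s and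
`U`'s) would give kernel proofs of `SegmentMeanValueAt 4, 8` by pure algebra — not done here (they are in the certified
window anyway).

WHAT THIS IS NOT: no stub of the line is closed; nothing on crux stmt-ValiantsHypothesis-14610 or on `VP` versus `VNP`.
-/

set_option linter.dupNamespace false

namespace Summit.ValiantsHypothesis.ValiantsHypothesis.Theorems.BarrierLever.ChowBenchmarkPeel

open Finset

variable {κ : Type*} [DecidableEq κ]

/-! ## 1. Transport of tables along a bijection of the point set -/

section Transport

variable {R : Type*} [CommRing R] {π π' : Type*} [DecidableEq π] [DecidableEq π']

/-- Restriction of a bijection of point sets to a row. -/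
noncomputable def rowMapEquiv (e : π ≃ π') (S : Finset π) : ↥S ≃ ↥(S.map e.toEmbedding) where
  toFun a := ⟨e a.1, Finset.mem_map_of_mem _ a.2⟩
  invFun b := ⟨e.symm b.1, by have := b.2; rw [Finset.mem_map_equiv] at this; exact this⟩
  left_inv a := Subtype.ext (e.symm_apply_apply a.1)
  right_inv b := Subtype.ext (e.apply_symm_apply b.1)

/-- Segment entries are invariant under relabelling the points: `segE (P ∘ e) S T = segE P (e '' S) T`. -/
theorem segE_comp_equiv (e : π ≃ π') (P : π' → κ → R) (S : Finset π) (T : Finset κ) :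
    segE (fun a => P (e a)) S T = segE P (S.map e.toEmbedding) T := by
  classical
  unfold segE
  set f := rowMapEquiv e S with hf
  have hbij : Function.Bijective (fun g : ↥T → ↥S => fun c => f (g c)) := by
    constructor
    · intro g g' h
      funext c
      exact f.injective (congrFun h c)
    · intro g'
      exact ⟨fun c => f.symm (g' c), funext fun c => f.apply_symm_apply (g' c)⟩
  refine Fintype.sum_bijective _ hbij _ _ fun g => ?_
  have h1 : (∏ c : ↥T, P (e ((g c : ↥S) : π)) c) = ∏ c : ↥T, P ((f (g c) : ↥(S.map e.toEmbedding)) : π') c :=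
    Finset.prod_congr rfl fun c _ => rfl
  have h2 : (∏ a : ↥S, ((Finset.univ.filter fun c : ↥T => g c = a).card.factorial : R)) =
      ∏ a : ↥(S.map e.toEmbedding),
        ((Finset.univ.filter fun c : ↥T => f (g c) = a).card.factorial : R) := by
    refine Fintype.prod_equiv f _ _ fun a => ?_
    have hfl : (Finset.univ.filter fun c : ↥T => g c = a) =
        Finset.univ.filter fun c : ↥T => f (g c) = f a := by
      ext c
      simp only [Finset.mem_filter, Finset.mem_univ, true_and]
      exact f.injective.eq_iff.symm
    rw [hfl]
  rw [h1, h2]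

end Transport

/-! ## 2. The enlarged configuration re-indexed by `Fin (n+1)` and `Row (n+1)` -/

section Reindex

variable {R : Type*} [CommRing R] {n : ℕ}

/-- An `Option (Fin n)`-indexed table read as a `Fin (n+1)`-indexed one (`Fin.last n` is the new point). -/
def finTable (P' : Option (Fin n) → κ → R) : Fin (n + 1) → κ → R := fun a => P' (finSuccEquivLast a)

omit [DecidableEq κ] [CommRing R] in
/-- `finTable` on an old point. -/
@[simp] theorem finTable_castSucc (P' : Option (Fin n) → κ → R) (a : Fin n) :
    finTable P' (Fin.castSucc a) = P' (some a) := by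
  simp [finTable, finSuccEquivLast_castSucc]

omit [DecidableEq κ] [CommRing R] in
/-- `finTable` on the new point. -/
@[simp] theorem finTable_last (P' : Option (Fin n) → κ → R) : finTable P' (Fin.last n) = P' none := by
  simp [finTable, finSuccEquivLast_last]

/-- Segment entries of the re-indexed table. -/
theorem segE_finTable (P' : Option (Fin n) → κ → R) (S : Finset (Fin (n + 1))) (T : Finset κ) :
    segE (finTable P') S T = segE P' (S.map finSuccEquivLast.toEmbedding) T :=
  segE_comp_equiv finSuccEquivLast P' S T

/-- The rows of the enlarged configuration, re-indexed: `Row n ⊕ Option (Fin n) ≃ Row (n+1)`. -/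
noncomputable def rowEquiv (n : ℕ) : (Row n ⊕ Option (Fin n)) ≃ Row (n + 1) :=
  Equiv.ofBijective
    (fun i => ⟨(rowSet i).map finSuccEquivLast.symm.toEmbedding, by
      rw [Finset.card_map]; exact card_rowSet_le_two i⟩)
    (by
      constructor
      · intro i j h
        have h' := congrArg (fun S : Row (n + 1) => S.1.map finSuccEquivLast.toEmbedding) h
        simp only [Finset.map_map] at h'
        have hid : (finSuccEquivLast.symm.toEmbedding.trans finSuccEquivLast.toEmbedding :
            Option (Fin n) ↪ Option (Fin n)) = Function.Embedding.refl _ := by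
          ext x; simp
        rw [hid, Finset.map_refl, Finset.map_refl] at h'
        exact rowSet_injective h'
      · intro S
        obtain ⟨i, hi⟩ := exists_rowSet_eq (S.1.map finSuccEquivLast.toEmbedding)
          (by rw [Finset.card_map]; exact S.2)
        refine ⟨i, Subtype.ext ?_⟩
        simp only [hi, Finset.map_map]
        have hid : (finSuccEquivLast.toEmbedding.trans finSuccEquivLast.symm.toEmbedding :
            Fin (n + 1) ↪ Fin (n + 1)) = Function.Embedding.refl _ := by
          ext x; simp
        rw [hid, Finset.map_refl])

/-- The defining property of `rowEquiv`: the row set of `rowEquiv i` is `rowSet i` read in `Fin (n+1)`. -/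
theorem map_rowEquiv (i : Row n ⊕ Option (Fin n)) :
    ((rowEquiv n i).1).map finSuccEquivLast.toEmbedding = rowSet i := by
  rw [rowEquiv, Equiv.ofBijective_apply]
  simp only [Finset.map_map]
  have hid : (finSuccEquivLast.symm.toEmbedding.trans finSuccEquivLast.toEmbedding :
      Option (Fin n) ↪ Option (Fin n)) = Function.Embedding.refl _ := by
    ext x; simp
  rw [hid, Finset.map_refl]

/-- **Transport of the determinant.**  The segment-moment matrix of the `Fin (n+1)`-indexed table `finTable P'` with rows
`Row (n+1)` and the transported column family is the re-indexing of the `Row n ⊕ Option (Fin n)`-indexed matrix. -/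
theorem det_finTable (P' : Option (Fin n) → κ → R) (col : Row n ⊕ Option (Fin n) → Finset κ) :
    (Matrix.of fun S S' : Row (n + 1) => segE (finTable P') S.1 (col ((rowEquiv n).symm S'))).det =
      (Matrix.of fun i j : Row n ⊕ Option (Fin n) => segE P' (rowSet i) (col j)).det := by
  rw [← Matrix.det_reindex_self (rowEquiv n)]
  congr 1
  ext S S'
  rw [Matrix.reindex_apply, Matrix.submatrix_apply, Matrix.of_apply, Matrix.of_apply, segE_finTable,
    ← map_rowEquiv ((rowEquiv n).symm S), Equiv.apply_symm_apply]

end Reindex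


/-! ## 3. Ring homomorphisms act on the peeling data -/

section Maps

variable {R R' : Type*} [CommRing R] [CommRing R'] {n : ℕ}

/-- Row `∅`: `segE P ∅ T = [T = ∅]` (any ring, any point type). -/
theorem segE_empty {π : Type*} [DecidableEq π] (P : π → κ → R) (T : Finset κ) :
    segE P (∅ : Finset π) T = if T = ∅ then 1 else 0 := by
  classical
  unfold segE
  by_cases hT : T = ∅
  · subst hT
    rw [if_pos rfl]
    haveI : Unique (↥(∅ : Finset κ) → ↥(∅ : Finset π)) := Pi.uniqueOfIsEmpty _
    rw [Fintype.sum_unique]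
    simp
  · rw [if_neg hT]
    haveI : Nonempty ↥T := by
      obtain ⟨c, hc⟩ := Finset.nonempty_iff_ne_empty.mpr hT
      exact ⟨⟨c, hc⟩⟩
    haveI : IsEmpty (↥T → ↥(∅ : Finset π)) := by infer_instance
    exact Fintype.sum_empty _

/-- Ring homomorphisms act on `starZ` entrywise. -/
theorem map_starZ (f : R →+* R') (P : Fin n → κ → R) (a : Fin n) (q : κ → R) (A T : Finset κ) :
    f (starZ P a q A T) = starZ (fun a c => f (P a c)) a (fun c => f (q c)) A T := by
  unfold starZ
  rw [map_sum]
  refine Finset.sum_congr rfl fun d _ => ?_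
  rw [map_mul, map_mul, map_mul, map_natCast, map_natCast, map_prod, map_prod]

/-- Ring homomorphisms act on `zEntry` entrywise. -/
theorem map_zEntry (f : R →+* R') (P : Fin n → κ → R) (q : κ → R) (A : Finset κ) (i : Option (Fin n))
    (T : Finset κ) :
    f (zEntry P q A i T) = zEntry (fun a c => f (P a c)) (fun c => f (q c)) A i T := by
  cases i with
  | none => rw [zEntry, zEntry, map_mul, map_natCast, map_prod]
  | some a => rw [zEntry, zEntry, map_starZ]

/-- At `q = 0` and `A ⊆ T` the block `zEntry` is `|A|!` times the Vandermonde block `vand`. -/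
theorem zEntry_zero_eq_vand (P : Fin n → κ → ℂ) (A T : Finset κ) (hAT : A ⊆ T) (i : Option (Fin n)) :
    zEntry P (fun _ => (0 : ℂ)) A i T = (A.card.factorial : ℂ) * vand P i (T \ A) := by
  cases i with
  | none =>
    rw [zEntry, vand]
    by_cases h : T \ A = ∅
    · have hTA : T = A := Finset.Subset.antisymm (Finset.sdiff_eq_empty_iff_subset.mp h) hAT
      rw [h, if_pos rfl, Finset.prod_empty, mul_one, mul_one, hTA]
    · obtain ⟨c, hc⟩ := Finset.nonempty_iff_ne_empty.mpr h
      rw [Finset.prod_eq_zero hc rfl, mul_zero, if_neg h, mul_zero]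
  | some a =>
    rw [zEntry_zero P A T hAT a, vand]
    ring

end Maps

/-! ## 4. Symbolic iteration: rigidly peelable column families are GTN instances -/

section Iterate

/-- The generic `n`-point table `P a c = X_{(a,c)}` over `MvPolynomial (Fin n × κ) ℂ`. -/
noncomputable def genTable (n : ℕ) : Fin n → κ → MvPolynomial (Fin n × κ) ℂ :=
  fun a c => MvPolynomial.X (a, c)

/-- **Rigidly peelable column families** (indexed by the rows `Row n`): the empty family at `n = 0`, and one peeling
step — a set `A` in no old column and `n+1` distinct new columns containing `A`, one of them `A` itself (placed at the
row `{new}`), the enlarged family re-indexed by `Row (n+1)` through `rowEquiv`. -/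
inductive Peelable : (n : ℕ) → (Row n → Finset κ) → Prop
  | zero (T : Row 0 → Finset κ) (hT : ∀ S, T S = ∅) : Peelable 0 T
  | step {n : ℕ} {T : Row n → Finset κ} (A : Finset κ) (U : Option (Fin n) → Finset κ)
      (hT : Peelable n T) (hA : ∀ S, ¬ A ⊆ T S) (hUA : ∀ j, A ⊆ U j) (hU0 : U none = A)
      (hU : Function.Injective U) :
      Peelable (n + 1) (fun S => Sum.elim T U ((rowEquiv n).symm S))

/-- **The generic determinant of a rigidly peelable family is a nonzero polynomial.** -/
theorem det_genTable_ne_zero {n : ℕ} {T : Row n → Finset κ} (h : Peelable n T) :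
    (Matrix.of fun S S' : Row n => segE (genTable n) S.1 (T S')).det ≠ 0 := by
  classical
  induction h with
  | zero T hT =>
    -- `Row 0` has exactly one row, `∅`
    letI : Unique (Row 0) :=
      { default := ⟨∅, by simp⟩, uniq := fun S => Subtype.ext (Finset.eq_empty_of_isEmpty S.1) }
    rw [Matrix.det_unique, Matrix.of_apply]
    have : (default : Row 0).1 = ∅ := rfl
    rw [this, segE_empty, hT, if_pos rfl]
    exact one_ne_zero
  | @step n T A U hT hA hUA hU0 hU ih =>
    -- the rings and tables
    set Rn := MvPolynomial (Fin n × κ) ℂ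
    set R := MvPolynomial (Fin (n + 1) × κ) ℂ with hR
    let old : Fin n → κ → R := fun a c => MvPolynomial.X (Fin.castSucc a, c)
    let q : κ → R := fun c => MvPolynomial.X (Fin.last n, c)
    -- (i) the old matrix is nonsingular in `R` (transport of the induction hypothesis along `rename`)
    let ι : Fin n × κ → Fin (n + 1) × κ := Prod.map Fin.castSucc id
    have hι : Function.Injective ι := (Fin.castSucc_injective n).prodMap Function.injective_id
    have hold : (Matrix.of fun S S' : Row n => segE old S.1 (T S')).det ≠ 0 := by
      have e : (Matrix.of fun S S' : Row n => segE old S.1 (T S')) =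
          (MvPolynomial.rename ι : Rn →ₐ[ℂ] R).toRingHom.mapMatrix
            (Matrix.of fun S S' : Row n => segE (genTable n) S.1 (T S')) := by
        refine Matrix.ext fun S S' => ?_
        rw [RingHom.mapMatrix_apply, Matrix.map_apply, Matrix.of_apply, Matrix.of_apply,
          map_segE (MvPolynomial.rename ι : Rn →ₐ[ℂ] R).toRingHom]
        congr 1
        funext a c
        show MvPolynomial.X (Fin.castSucc a, c) = MvPolynomial.rename ι (MvPolynomial.X (a, c))
        rw [MvPolynomial.rename_X]
        rfl
      rw [e, ← RingHom.map_det]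
      intro h0
      apply ih
      apply MvPolynomial.rename_injective ι hι
      rw [map_zero]
      exact h0
    -- (ii) the block `zEntry` is nonsingular in `R`: evaluate at `q = 0`, old points = indicator table
    let g : Fin (n + 1) × κ → ℂ := fun p =>
      match finSuccEquivLast p.1 with
      | none => 0
      | some i => if p.2 ∈ U (some i) \ A then 1 else 0
    have hgold : (fun a c => MvPolynomial.eval g (old a c)) = indTable U A := by
      funext a c
      simp [old, g, MvPolynomial.eval_X, finSuccEquivLast_castSucc, indTable]
    have hgq : (fun c => MvPolynomial.eval g (q c)) = fun _ => (0 : ℂ) := by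
      funext c
      simp [q, g, MvPolynomial.eval_X, finSuccEquivLast_last]
    have hZ : (Matrix.of fun i j : Option (Fin n) => zEntry old q A i (U j)).det ≠ 0 := by
      intro h0
      have h1 := congrArg (MvPolynomial.eval g) h0
      rw [RingHom.map_det, map_zero] at h1
      have e : (MvPolynomial.eval g).mapMatrix (Matrix.of fun i j : Option (Fin n) => zEntry old q A i (U j)) =
          Matrix.of fun i j : Option (Fin n) =>
            (fun _ : Option (Fin n) => (A.card.factorial : ℂ)) i *
              (Matrix.of fun i j : Option (Fin n) => vand (indTable U A) i (U j \ A)) i j := by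
        refine Matrix.ext fun i j => ?_
        rw [RingHom.mapMatrix_apply, Matrix.map_apply, Matrix.of_apply, Matrix.of_apply, map_zEntry, hgold, hgq,
          zEntry_zero_eq_vand _ _ _ (hUA j), Matrix.of_apply]
      rw [e, Matrix.det_mul_column, Finset.prod_const] at h1
      exact (mul_ne_zero (pow_ne_zero _ (Nat.cast_ne_zero.mpr (Nat.factorial_ne_zero _)))
        (det_vand_indTable_ne_zero U A hU0 hUA hU)) h1
    -- (iii) the peeling lemma: the symbolic determinant (new point `q + x·𝟙_A`) is nonzero in `R[X]`
    have hsymb := det_symbMatrixQ_ne_zero old q T U A hA hUA hold hZ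
    -- (iv) the shift `X_{(last,c)} ↦ X_{(last,c)} + x·[c ∈ A]` maps the generic determinant to the symbolic one
    let ψ : R →ₐ[ℂ] Polynomial R := MvPolynomial.aeval fun p : Fin (n + 1) × κ =>
      Polynomial.C (MvPolynomial.X p) + (if p.1 = Fin.last n then indPt A Polynomial.X p.2 else 0)
    have hψX : ∀ (a : Fin (n + 1)) (c : κ), ψ (genTable (n + 1) a c) =
        Polynomial.C (MvPolynomial.X (a, c)) + (if a = Fin.last n then indPt A Polynomial.X c else 0) :=
      fun a c => MvPolynomial.aeval_X _ _
    have hψtab : (fun a c => ψ (genTable (n + 1) a c)) = finTable (symbTableQ old q A) := by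
      funext a c
      rw [hψX]
      induction a using Fin.lastCases with
      | last =>
        rw [finTable_last, if_pos rfl]
        rfl
      | cast i =>
        rw [finTable_castSucc, if_neg (Fin.castSucc_lt_last i).ne, add_zero]
        rfl
    intro h0
    have h1 := congrArg ψ.toRingHom h0
    rw [map_zero, RingHom.map_det] at h1
    have e : ψ.toRingHom.mapMatrix (Matrix.of fun S S' : Row (n + 1) =>
        segE (genTable (n + 1)) S.1 (Sum.elim T U ((rowEquiv n).symm S'))) =
        Matrix.of fun S S' : Row (n + 1) =>
          segE (finTable (symbTableQ old q A)) S.1 (Sum.elim T U ((rowEquiv n).symm S')) := by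
      refine Matrix.ext fun S S' => ?_
      rw [RingHom.mapMatrix_apply, Matrix.map_apply, Matrix.of_apply, Matrix.of_apply, map_segE, ← hψtab]
      rfl
    rw [e, det_finTable] at h1
    exact hsymb h1

/-- **Every rigidly peelable column family is a GTN instance**: some complex table makes the segment-moment matrix
(rows = all subsets of size `≤ 2`, indexed by `Row n`; columns `T`) nonsingular. -/
theorem exists_table_of_peelable {n : ℕ} {T : Row n → Finset κ} (h : Peelable n T) :
    ∃ P : Fin n → κ → ℂ, (Matrix.of fun S S' : Row n => segE P S.1 (T S')).det ≠ 0 := by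
  classical
  by_contra hall
  simp only [not_exists, not_not] at hall
  apply det_genTable_ne_zero h
  apply MvPolynomial.funext
  intro x
  rw [map_zero, RingHom.map_det]
  have e : (MvPolynomial.eval x).mapMatrix (Matrix.of fun S S' : Row n => segE (genTable n) S.1 (T S')) =
      Matrix.of fun S S' : Row n => segE (fun a c => x (a, c)) S.1 (T S') := by
    refine Matrix.ext fun S S' => ?_
    rw [RingHom.mapMatrix_apply, Matrix.map_apply, Matrix.of_apply, Matrix.of_apply, map_segE]
    congr 1
    funext a c
    simp [genTable]
  rw [e]
  exact hall _


/-! ### In the frame of the typed node `Stmt.gtn` (rows enumerated by `u : Fin r → Finset (Fin h)`) -/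

/-- The row enumeration of the node as a bijection `Fin r ≃ Row h`. -/
noncomputable def rowIndex {h r : ℕ} (u : Fin r → Finset (Fin h)) (hu : Function.Injective u)
    (hcard : ∀ i, (u i).card ≤ 2) (hsurj : ∀ S : Finset (Fin h), S.card ≤ 2 → ∃ i, u i = S) : Fin r ≃ Row h :=
  Equiv.ofBijective (fun i => ⟨u i, hcard i⟩)
    ⟨fun i j e => hu (congrArg Subtype.val e), fun S => by
      obtain ⟨i, hi⟩ := hsurj S.1 S.2
      exact ⟨i, Subtype.ext hi⟩⟩

/-- **GTN for rigidly peelable families, in the node's frame.**  If the column family `T : Fin r → Finset (Fin h)`,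
re-indexed by the rows through the enumeration `u`, is rigidly peelable, then some table makes the node's matrix
`[segEntry P (u i) (T j)]` nonsingular — an instance of `ChowBenchmarkGTN.Stmt.gtn` (whose entry is `segE` verbatim). -/
theorem exists_table_of_peelable_enum {h r : ℕ} (u : Fin r → Finset (Fin h)) (hu : Function.Injective u)
    (hcard : ∀ i, (u i).card ≤ 2) (hsurj : ∀ S : Finset (Fin h), S.card ≤ 2 → ∃ i, u i = S)
    (T : Fin r → Finset (Fin h)) (hT : Peelable h (fun S => T ((rowIndex u hu hcard hsurj).symm S))) :
    ∃ P : Fin h → Fin h → ℂ,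
      (Matrix.of fun i j : Fin r =>
        ∑ g : (↥(T j) → ↥(u i)), (∏ c : ↥(T j), P (g c) c) *
          ∏ a : ↥(u i), ((Finset.univ.filter fun c : ↥(T j) => g c = a).card.factorial : ℂ)).det ≠ 0 := by
  obtain ⟨P, hP⟩ := exists_table_of_peelable hT
  refine ⟨P, ?_⟩
  set σ := rowIndex u hu hcard hsurj with hσ
  have hval : ∀ i, (σ i).1 = u i := fun i => rfl
  have e : (Matrix.of fun S S' : Row h => segE P S.1 (T (σ.symm S'))) =
      Matrix.reindex σ σ (Matrix.of fun i j : Fin r => segE P (u i) (T j)) := by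
    refine Matrix.ext fun S S' => ?_
    rw [Matrix.reindex_apply, Matrix.submatrix_apply, Matrix.of_apply, Matrix.of_apply, ← hval (σ.symm S),
      Equiv.apply_symm_apply]
  rw [e, Matrix.det_reindex_self] at hP
  exact hP

end Iterate

end Summit.ValiantsHypothesis.ValiantsHypothesis.Theorems.BarrierLever.ChowBenchmarkPeel
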